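import Literature.NumberTheory.EllipticCurves.Kobayashi2003.SignedSelmer
import Mathlib.GroupTheory.Torsion
import HarnessLib

/-!
# Kobayashi's STRICT-minus Selmer structure: the signed local condition WITH the `m = −1` clause
# of §2 / Def. 2.1, in `W`-coordinates over the cyclotomic tower (cell `b2b-bsdres`, team n1011,
# r = 1 strand, seat p17 GEN 3; row T-O7ss-P13 FILE 2a = prover target (P1) of cc-typer-6's
# `Additive/QuadraticBranchOddStrictSelmer.lean`, p259634)

HONEST FRAMING (cell `b2b-bsdres`, run/shared/lean/b2b/bsd-rank1-residual/, verbatim in every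
file): the goal of the cell is to DELETE the COMBINATION-SHAPED residual classes of the
Birch–Swinnerton-Dyer formula for ALL analytic-rank `≤ 1` elliptic curves over `ℚ` — "full BSD
formula for every rank `≤ 1` curve in class `C`" assembled STRICTLY from published theorems — so
that the rank-`≤ 1` remainder becomes exactly the CONSTRUCTION-SHAPED classes, which are TYPED
(missing-input `Prop`s), NOT attempted. This is not "finishing BSD". Team n1011: prove what is
provable now; shrink each hard class to its core with data; no claim beyond stated classes; research
routes; census output = EVIDENCE / conjecture items, never a Literature fact; RESIDUAL-MAP marks
change only by signed lines. O7-ss stays OPEN, X4 CONSTRUCTION-SHAPED; nothing here is booked; no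
label moves. VOCABULARY ONLY: definitions with bodies + unfolding / comparison lemmas + ONE
hypothesis structure (field for field the tree's `Kobayashi2003.SignedSelmerDualData`); NOTHING is
asserted (Kobayashi's Thm. 2.2 / 4.1 and Kitajima–Otsuki's theorem are NOT stated here); no named
Literature fact; `#print axioms` standard.

## Source and reading

Kobayashi, Invent. Math. 152 (2003), §2 p. 4 (held copy `paper:doi-10-1007-s00222-002-0265-4`),
verbatim: "Let `K_n = ℚ(ζ_{p^{n+1}})`, `K_{−1} = ℚ` … `E⁻(K_{n,v}) = {P ∈ Ê(K_{n,v}) | Tr_{n/m+1} P ∈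
Ê(K_{m,v}) for odd m (−1 ≤ m < n)}`" — the MINUS condition carries the extra clause `m = −1`:
`Tr_{n/0} P ∈ Ê(K_{−1,v}) = Ê(ℚ_p)`; Def. 2.1 (p. 5) builds `Sel^±(E/K_n)`, `Sel^±(E/K_∞)`, `X^±`
from these groups, component by component in the characters `η` of `Δ = Gal(K_0/ℚ)`. The tree's
`Kobayashi2003/SignedSelmer.lean` transcribes Def. 1.1 (the `F_n = ℚ_n` tower, `0 ≤ m < n`, NO
`m = −1` clause) for a general number field `K` and `ℤ_p`-extension `κ`, and names the
`K_n`-tower / `−1 ≤ m` variant as TODO.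

THIS FILE supplies the `m = −1` clause in `W`-COORDINATES (cc-typer-6's route note
`HOME/class-closure/O10/ROUTE-ETA-ODD-STRICT-typer6.md`; p259634 module docstring, target (P1)):
for `W = V ⊗ η` the `p*`-twist of a good supersingular `a_p = 0` curve `V`, `η = ω^{(p−1)/2}`, the
`η`-part of `V̂(K_{n,v})` is `W(ℚ_{n,p}) ⊗ ℤ_p` and `V̂(ℚ_p)^η = 0`, so on the `η`-component the
clause reads **"`Tr_{n/0} P` is torsion"** (cc-typer-6's wording). The variants "`Tr_{n/0} P = 0`" /
"of order prime to `p`" cut out subgroups of finite index in ours, hence the SAME Kummer local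
condition (`A ≤ A′` of finite index ⟹ `A ⊗ ℚ_p/ℤ_p ↠ A′ ⊗ ℚ_p/ℤ_p`); we take the largest. So:

* `strictSignedLocalPointsOfEmb κ ι W ε n` = `signedLocalPointsOfEmb κ ι W ε n` ⊓ (for `ε = −1`
  only) `{P | Tr_{n/0} P ∈ torsion}` — for `ε = 1` it IS the tree's plus group (Def. 2.1 has no
  extra clause on the even side: `strictSignedLocalPointsOfEmb_one`); at the bottom layer `n = 0` the
  minus group is `{P ∈ E(K_0·E) | P torsion}` (`mem_strictSignedLocalPointsOfEmb_neg_one_zero_iff`),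
  whose Kummer image is ZERO — the `p`-STRICT local condition (FILE 3 of the row identifies the
  bottom layer with cc-typer-6's `strictSelmerPInfty W p`);
* `strictSignedSelmerLayer W κ E ε n`, `strictSignedSelmerInfty W κ E ε` — Def. 2.1's shape on
  the tree's `selmerLayer` / `layerToInfty`, word for word as `signedSelmerLayer` /
  `signedSelmerInfty`, the strict signed local condition being imposed at a caller-supplied MODEL
  `E` of the completion of `K` at the place above `p` (the condition at `closureEmb E` and at all
  its `Γ_K`-conjugates, i.e. at every place of `K_n` above that place, exactly as `selmerGroupOver`
  imposes local conditions). Kobayashi's setting has ONE place above `p` (`F = ℚ`, `F_{n,p}`); for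
  `K = ℚ` one takes `E = ℚ_[p]` (Mathlib's model, the one of the tree's `p`-strict Selmer group
  `selmerLocalKerPrimaryTorsion W ℚ_[p] p`) or `E = ℚ_v`; the classical conditions stay the tree's
  `selmerLayer` (all places, adic completions). TODO(general form): several places of `K` above `p`
  (impose the condition at a family of models). PROVED: `≤` the classical groups, stability under
  the conjugation action of `Γ_K`;
* `StrictSignedSelmerDualData W κ E γ ε` — the Pontryagin dual `X^{ε,str}(E/K_∞)` as a HYPOTHESIS
  STRUCTURE, field for field `SignedSelmerDualData` (its EXISTENCE, the `conj` endomorphism and the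
  bottom-layer bound are FILE 2b).

The definitions make sense for every `K`, `κ`, `W`, `p`, `E`, `ε`; the intended instance is `K = ℚ`,
`κ` cyclotomic, `E = ℚ_[p]`, `ε = −1`, `W` the additive `p*`-twist of a good `a_p = 0` curve.
Nothing in this file depends on that instance.

References: [Kobayashi2003] §2 p. 4, Def. 2.1 (p. 5), Def. 1.1 (p. 2); [GreenbergLNM1716] §1 p. 60
(the dual as a `Λ`-module); cc-typer-6's p259634 (targets (P1)–(P4)).
-/

noncomputable section

open scoped Classical

open NumberField IsDedekindDomain

universe u

namespace Summit.BirchSwinnertonDyer.Rank1Residual.Additive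

open Literature.NumberTheory.EllipticCurves Literature.NumberTheory.GaloisRepresentations
  Literature.NumberTheory.EllipticCurves.Kobayashi2003 ZpExtension

/-! ## §1 The strict signed local groups -/

section Local

variable {K : Type u} [Field K] {p : ℕ} [Fact p.Prime] (κ : ZpExtension K p)
variable {E : Type u} [Field E] [Algebra K E] (ι : AlgebraicClosure K →ₐ[K] AlgebraicClosure E)
variable (W : WeierstrassCurve K)

/-- **Kobayashi's `E^ε(K_n·E)` WITH the `m = −1` clause, in `W`-coordinates** (`ε = 1`: `E⁺`,
unchanged; `ε = −1`: `E⁻` of §2 / Def. 2.1): the points `P ∈ E^ε(K_n·E)` of the tree's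
`signedLocalPointsOfEmb` (Def. 1.1: `Tr_{n/m+1} P ∈ E(K_m·E)` for every `m < n` with `(−1)^m = ε`)
such that, when `ε = −1`, the trace to the bottom layer `Tr_{n/0} P` is a TORSION point — the
`η`-component reading of "`Tr_{n/0} P ∈ Ê(K_{−1,v})`, `K_{−1} = ℚ`" (`V̂(ℚ_p)^η = 0`; module
docstring). An additive subgroup. [cite: Kobayashi2003, §2 p. 4 and Def. 2.1 (p. 5)] -/
def strictSignedLocalPointsOfEmb (ε : ℤˣ) (n : ℕ) : AddSubgroup (localPoints W E) where
  carrier := {P | P ∈ signedLocalPointsOfEmb κ ι W ε n ∧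
    (ε = -1 → localTraceOfEmb κ ι W 0 n P ∈ AddCommGroup.torsion (localPoints W E))}
  zero_mem' := ⟨zero_mem _, fun _ => by rw [map_zero]; exact zero_mem _⟩
  add_mem' := fun {P Q} hP hQ => ⟨add_mem hP.1 hQ.1, fun hε => by
    rw [map_add]; exact add_mem (hP.2 hε) (hQ.2 hε)⟩
  neg_mem' := fun {P} hP => ⟨neg_mem hP.1, fun hε => by
    rw [map_neg]; exact neg_mem (hP.2 hε)⟩

/-- Membership in the strict signed local group (unfolding). [cite: Kobayashi2003, §2 p. 4 and Def. 2.1 (p. 5)] -/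
theorem mem_strictSignedLocalPointsOfEmb_iff (ε : ℤˣ) (n : ℕ) (P : localPoints W E) :
    P ∈ strictSignedLocalPointsOfEmb κ ι W ε n ↔ P ∈ signedLocalPointsOfEmb κ ι W ε n ∧
      (ε = -1 → localTraceOfEmb κ ι W 0 n P ∈ AddCommGroup.torsion (localPoints W E)) :=
  Iff.rfl

/-- The strict group refines Kobayashi's Def. 1.1 group: `E^{ε,str}(K_n·E) ≤ E^ε(K_n·E)`.
[cite: Kobayashi2003, Def. 1.1 and Def. 2.1] -/
theorem strictSignedLocalPointsOfEmb_le (ε : ℤˣ) (n : ℕ) :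
    strictSignedLocalPointsOfEmb κ ι W ε n ≤ signedLocalPointsOfEmb κ ι W ε n :=
  fun _ hP => hP.1

/-- … and hence lies in `E(K_n·E)`. [cite: Kobayashi2003, Def. 1.1 and Def. 2.1] -/
theorem strictSignedLocalPointsOfEmb_le_localLayerPoints (ε : ℤˣ) (n : ℕ) :
    strictSignedLocalPointsOfEmb κ ι W ε n ≤ localLayerPointsOfEmb κ ι W n :=
  (strictSignedLocalPointsOfEmb_le κ ι W ε n).trans (signedLocalPointsOfEmb_le κ ι W ε n)

/-- **The plus side carries no extra clause** (Def. 2.1: `E⁺(K_{n,v})` quantifies over even `m` with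
`0 ≤ m < n` only): `E^{+,str} = E⁺`. [cite: Kobayashi2003, Def. 2.1 (p. 5)] -/
theorem strictSignedLocalPointsOfEmb_one (n : ℕ) :
    strictSignedLocalPointsOfEmb κ ι W 1 n = signedLocalPointsOfEmb κ ι W 1 n := by
  ext P
  rw [mem_strictSignedLocalPointsOfEmb_iff]
  have h : (1 : ℤˣ) ≠ -1 := by decide
  simp only [h, IsEmpty.forall_iff, and_true]

/-- The minus side: `P ∈ E^{−,str}(K_n·E) ↔ P ∈ E⁻(K_n·E) ∧ Tr_{n/0} P` is torsion.
[cite: Kobayashi2003, §2 p. 4 and Def. 2.1 (p. 5)] -/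
theorem mem_strictSignedLocalPointsOfEmb_neg_one_iff (n : ℕ) (P : localPoints W E) :
    P ∈ strictSignedLocalPointsOfEmb κ ι W (-1) n ↔ P ∈ signedLocalPointsOfEmb κ ι W (-1) n ∧
      localTraceOfEmb κ ι W 0 n P ∈ AddCommGroup.torsion (localPoints W E) := by
  rw [mem_strictSignedLocalPointsOfEmb_iff]
  simp only [forall_const]

/-- **The bottom layer of the minus side is the TORSION of `E(E)`**: `E^{−,str}(K_0·E) =
{P ∈ E(K_0·E) | P torsion}` (`Tr_{0/0} P = P`, `localTraceOfEmb_self_of_mem`; `E⁻(K_0·E) = E(K_0·E)`,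
`signedLocalPointsOfEmb_zero`) — the `η`-part reading of `E⁻(K_{0,v})^η ⊆ V̂(ℚ_p)^η = 0`: the local
condition at `p` DIES at the bottom of the odd branch. [cite: Kobayashi2003, §2 p. 4 (m = −1, K_{−1} = ℚ)] -/
theorem mem_strictSignedLocalPointsOfEmb_neg_one_zero_iff (P : localPoints W E) :
    P ∈ strictSignedLocalPointsOfEmb κ ι W (-1) 0 ↔
      P ∈ localLayerPointsOfEmb κ ι W 0 ∧ P ∈ AddCommGroup.torsion (localPoints W E) := by
  rw [mem_strictSignedLocalPointsOfEmb_neg_one_iff, signedLocalPointsOfEmb_zero]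
  constructor
  · rintro ⟨h0, ht⟩
    rw [localTraceOfEmb_self_of_mem κ ι W 0 h0] at ht
    exact ⟨h0, ht⟩
  · rintro ⟨h0, ht⟩
    rw [localTraceOfEmb_self_of_mem κ ι W 0 h0]
    exact ⟨h0, ht⟩

/-- Torsion points of the bottom layer `E(E) = E(K_0·E)` lie in EVERY strict signed group: on a point
fixed by `Γ_E` each trace is multiplication by an index (`localTraceOfEmb_apply_of_mem_lower`), which
keeps torsion torsion (and `E(E) ≤ E^ε(K_n·E)`, `localLayerPointsOfEmb_zero_le_signedLocalPointsOfEmb`).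
[cite: Kobayashi2003, Def. 1.1 and §2 p. 4] -/
theorem mem_strictSignedLocalPointsOfEmb_of_mem_zero_of_mem_torsion (ε : ℤˣ) (n : ℕ)
    {P : localPoints W E} (h0 : P ∈ localLayerPointsOfEmb κ ι W 0)
    (ht : P ∈ AddCommGroup.torsion (localPoints W E)) :
    P ∈ strictSignedLocalPointsOfEmb κ ι W ε n := by
  refine ⟨localLayerPointsOfEmb_zero_le_signedLocalPointsOfEmb κ ι W ε n h0, fun _ => ?_⟩
  rw [localTraceOfEmb_apply_of_mem_lower κ ι W 0 n h0]
  exact AddSubgroup.nsmul_mem _ ht _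

variable (E)

/-- **`E^{ε,str}(K_n·K_v)`** for the chosen embedding `closureEmb E` (`E = K_v`).
[cite: Kobayashi2003, §2 p. 4 and Def. 2.1 (p. 5)] -/
abbrev strictSignedLocalPoints (ε : ℤˣ) (n : ℕ) : AddSubgroup (localPoints W E) :=
  strictSignedLocalPointsOfEmb κ (closureEmb (K := K) E) W ε n

end Local

/-! ## §2 `Sel^{ε,str}(E/K_n)` and `Sel^{ε,str}(E/K_∞)` -/

section Selmer

variable {K : Type u} [Field K] [NumberField K] (W : WeierstrassCurve K) {p : ℕ} [Fact p.Prime]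
  (κ : ZpExtension K p) (E : Type u) [Field E] [Algebra K E]

/-- **`Sel^{ε,str}(E/K_n)`** — Def. 2.1's shape in `W`-coordinates: the classical Selmer group
`Sel_{p^∞}(E/K_n)` (`selmerLayer`) cut down, at the chosen model `E` of the completion of `K` at
the place above `p` and at every `Γ_K`-conjugate (`conj_σ`, `σ ∈ Γ_K`: every place of `K_n` above
that place, as in `selmerGroupOver` / `signedSelmerLayer`), to the classes whose local restriction
lies in the Kummer image of the STRICT signed group `E^{ε,str}(K_n·E)`. For `K = ℚ`, `E = ℚ_[p]`:
Kobayashi's `Sel⁻(E/K_n)^η` in `W`-coordinates (`ε = −1`). [cite: Kobayashi2003, Def. 2.1 (p. 5)] -/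
def strictSignedSelmerLayer (ε : ℤˣ) (n : ℕ) : AddSubgroup (W.subgroupH1 p (κ.layerSubgroup n)) :=
  W.selmerLayer κ n ⊓
    ⨅ (σ : Field.absoluteGaloisGroup K),
      (localKummerOverOfEmb W p (κ.layerSubgroup n) (closureEmb (K := K) E)
          (strictSignedLocalPoints κ E W ε n)).comap
        (W.conjH1 p (κ.layerSubgroup n) σ)

/-- Membership in `Sel^{ε,str}(E/K_n)`. [cite: Kobayashi2003, Def. 2.1 (p. 5)] -/
theorem mem_strictSignedSelmerLayer_iff (ε : ℤˣ) (n : ℕ) (c : W.subgroupH1 p (κ.layerSubgroup n)) :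
    c ∈ strictSignedSelmerLayer W κ E ε n ↔ c ∈ W.selmerLayer κ n ∧
      ∀ σ : Field.absoluteGaloisGroup K,
        W.conjH1 p (κ.layerSubgroup n) σ c ∈
          localKummerOverOfEmb W p (κ.layerSubgroup n) (closureEmb (K := K) E)
            (strictSignedLocalPoints κ E W ε n) := by
  simp only [strictSignedSelmerLayer, AddSubgroup.mem_inf, AddSubgroup.mem_iInf, AddSubgroup.mem_comap]

/-- `Sel^{ε,str}(E/K_n) ≤ Sel_{p^∞}(E/K_n)`. [cite: Kobayashi2003, Def. 2.1 (p. 5)] -/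
theorem strictSignedSelmerLayer_le_selmerLayer (ε : ℤˣ) (n : ℕ) :
    strictSignedSelmerLayer W κ E ε n ≤ W.selmerLayer κ n :=
  inf_le_left

/-- The strict signed condition at the chosen embedding itself (`σ = 1`; `conjH1_one_holds`).
[cite: Kobayashi2003, Def. 2.1 (p. 5)] -/
theorem mem_localKummerOverOfEmb_of_mem_strictSignedSelmerLayer (ε : ℤˣ) (n : ℕ)
    {c : W.subgroupH1 p (κ.layerSubgroup n)} (hc : c ∈ strictSignedSelmerLayer W κ E ε n) :
    c ∈ localKummerOverOfEmb W p (κ.layerSubgroup n) (closureEmb (K := K) E)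
      (strictSignedLocalPoints κ E W ε n) := by
  have h := ((mem_strictSignedSelmerLayer_iff W κ E ε n c).mp hc).2 1
  rwa [W.conjH1_one_holds p (κ.layerSubgroup n), AddMonoidHom.id_apply] at h

/-- **`Sel^{ε,str}(E/K_∞) := lim→_n Sel^{ε,str}(E/K_n)`** inside `H¹(K_∞, E[p^∞])`: the union of
the images under the restrictions `layerToInfty κ n` (as `signedSelmerInfty`).
[cite: Kobayashi2003, Def. 2.1 (p. 5)] -/
def strictSignedSelmerInfty (ε : ℤˣ) : AddSubgroup (W.subgroupH1 p κ.kerSubgroup) :=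
  ⨆ n : ℕ, (strictSignedSelmerLayer W κ E ε n).map (W.layerToInfty κ n)

/-- Each `Sel^{ε,str}(E/K_n)` maps into `Sel^{ε,str}(E/K_∞)`. [cite: Kobayashi2003, Def. 2.1 (p. 5)] -/
theorem map_layerToInfty_strictSignedSelmerLayer_le (ε : ℤˣ) (n : ℕ) :
    (strictSignedSelmerLayer W κ E ε n).map (W.layerToInfty κ n) ≤ strictSignedSelmerInfty W κ E ε :=
  le_iSup (fun n => (strictSignedSelmerLayer W κ E ε n).map (W.layerToInfty κ n)) n

/-- `Sel^{ε,str}(E/K_∞) ≤ Sel_{p^∞}(E/K_∞)` (each image of `Sel^{ε,str}(E/K_n) ≤ Sel(E/K_n)` lands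
in `Sel(E/K_∞)`, `map_layerToInfty_selmerLayer_le_holds`). [cite: Kobayashi2003, Def. 2.1 (p. 5)] -/
theorem strictSignedSelmerInfty_le_selmerInfty (ε : ℤˣ) :
    strictSignedSelmerInfty W κ E ε ≤ W.selmerInfty κ :=
  iSup_le fun n => (AddSubgroup.map_mono (strictSignedSelmerLayer_le_selmerLayer W κ E ε n)).trans
    (W.map_layerToInfty_selmerLayer_le_holds κ n)

/-- `Sel^{ε,str}(E/K_n)` is stable under the conjugation action of `Γ_K` on `H¹(K_n, E[p^∞])`: the
classical part by `map_conjH1_selmerGroupOver_le_holds`, the strict conditions because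
`conj_σ ∘ conj_γ = conj_{σγ}` permutes them (`conjH1_mul_holds`) — word for word
`conjH1_mem_signedSelmerLayer`. [cite: Kobayashi2003, Def. 2.1 (p. 5)] -/
theorem conjH1_mem_strictSignedSelmerLayer (ε : ℤˣ) (n : ℕ) (γ : Field.absoluteGaloisGroup K)
    {c : W.subgroupH1 p (κ.layerSubgroup n)} (hc : c ∈ strictSignedSelmerLayer W κ E ε n) :
    W.conjH1 p (κ.layerSubgroup n) γ c ∈ strictSignedSelmerLayer W κ E ε n := by
  rw [mem_strictSignedSelmerLayer_iff] at hc ⊢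
  refine ⟨W.map_conjH1_selmerGroupOver_le_holds p (κ.layerSubgroup n) γ ⟨c, hc.1, rfl⟩,
    fun σ => ?_⟩
  rw [← AddMonoidHom.comp_apply,
    ← conjH1_mul_holds (κ.layerSubgroup n) (W.geomPrimaryTorsion p) σ γ]
  exact hc.2 (σ * γ)

/-- **`Sel^{ε,str}(E/K_∞)` is stable under the conjugation action of `Γ_K`** on `H¹(K_∞, E[p^∞])`
— the action through which `Λ` acts on its Pontryagin dual; discharges the field `conj_mem` of
`StrictSignedSelmerDualData` (restriction commutes with conjugation, `resOfLe_comp_conjH1_holds`) —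
word for word `conjH1_mem_signedSelmerInfty`. [cite: Kobayashi2003, Def. 2.1 (p. 5)] -/
theorem conjH1_mem_strictSignedSelmerInfty (ε : ℤˣ) (γ : Field.absoluteGaloisGroup K)
    {s : W.subgroupH1 p κ.kerSubgroup} (hs : s ∈ strictSignedSelmerInfty W κ E ε) :
    W.conjH1 p κ.kerSubgroup γ s ∈ strictSignedSelmerInfty W κ E ε := by
  refine AddSubgroup.iSup_induction
    (fun n => (strictSignedSelmerLayer W κ E ε n).map (W.layerToInfty κ n))
    (C := fun s => W.conjH1 p κ.kerSubgroup γ s ∈ strictSignedSelmerInfty W κ E ε) hs ?_ ?_ ?_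
  · rintro n s ⟨c, hc, rfl⟩
    refine map_layerToInfty_strictSignedSelmerLayer_le W κ E ε n
      ⟨W.conjH1 p (κ.layerSubgroup n) γ c, conjH1_mem_strictSignedSelmerLayer W κ E ε n γ hc, ?_⟩
    change ((W.resOfLe p (κ.kerSubgroup_le_layerSubgroup n)).comp
        (W.conjH1 p (κ.layerSubgroup n) γ)) c = _
    rw [resOfLe_comp_conjH1_holds]
    rfl
  · rw [map_zero]; exact zero_mem _
  · intro s t hs ht; rw [map_add]; exact add_mem hs ht

end Selmer

/-! ## §3 The Pontryagin dual `X^{ε,str}(E/K_∞)` as a hypothesis structure -/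

section Dual

variable {K : Type u} [Field K] [NumberField K] {p : ℕ} [Fact p.Prime]

/-- **Pontryagin-dual data for `Sel^{ε,str}(E/K_∞)`** (strict condition at the model `E`) — field for field the tree's
`Kobayashi2003.SignedSelmerDualData` with `signedSelmerInfty ↦ strictSignedSelmerInfty`: the Iwasawa
module `X^{ε,str}(E/K_∞) = Hom(Sel^{ε,str}(E/K_∞), ℚ_p/ℤ_p)` as an abstract `Λ = ℤ_p⟦T⟧`-module `X`
with `conj_mem` (stability under `conj_γ`, dischargeable by `conjH1_mem_strictSignedSelmerInfty`),
`toDual : X ≃ Hom(Sel^{ε,str}_∞, ℚ/ℤ)`, `T ↔ conj_γ − 1`, constants through `ℤ_p → ℤ/pᵏ`. For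
`K = ℚ`, `κ` cyclotomic, `ε = −1`, `W` the `p*`-twist of a good `a_p = 0` curve `V`: the
`W`-coordinate avatar of Kobayashi's `X⁻(V/K_∞)^η`, `η = ω^{(p−1)/2}` (the object of the ODD main
conjecture and of Thm. 4.1 at `η`). NOTHING about existence (FILE 2b), finite generation, torsion
(Thm. 2.2) or finite submodules (Kitajima–Otsuki) is asserted here.
[cite: Kobayashi2003, Def. 2.1 and Thm. 2.2 (p. 5; the object only)] [cite: GreenbergLNM1716, §1 (p. 60)] -/
structure StrictSignedSelmerDualData (W : WeierstrassCurve K) (κ : ZpExtension K p)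
    (E : Type u) [Field E] [Algebra K E] (γ : Field.absoluteGaloisGroup K) (ε : ℤˣ) where
  /-- The underlying type of the Iwasawa module `X^{ε,str}(E/K_∞)`. -/
  X : Type u
  /-- `X` is an abelian group. -/
  [addCommGroup : AddCommGroup X]
  /-- `X` is a `Λ = ℤ_p⟦T⟧`-module. -/
  [module : Module (IwasawaAlgebra p) X]
  /-- `Sel^{ε,str}(E/K_∞)` is stable under conjugation by `γ` (hypothesis field; holds by
  `conjH1_mem_strictSignedSelmerInfty`). -/
  conj_mem : ∀ s ∈ strictSignedSelmerInfty W κ E ε,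
    W.conjH1 p κ.kerSubgroup γ s ∈ strictSignedSelmerInfty W κ E ε
  /-- The identification of `X` with the character group `Hom(Sel^{ε,str}_∞, ℚ/ℤ)`. -/
  toDual : X →+ (strictSignedSelmerInfty W κ E ε →+ AddCircle (1 : ℚ))
  /-- `toDual` is a group isomorphism. -/
  bijective : Function.Bijective toDual
  /-- `T` acts as `γ - 1`: `(T·x)(s) = x(conj_γ s) - x(s)`. -/
  toDual_T_smul : ∀ (x : X) (s : strictSignedSelmerInfty W κ E ε),
    toDual ((PowerSeries.X : IwasawaAlgebra p) • x) s =
      toDual x ⟨W.conjH1 p κ.kerSubgroup γ s, conj_mem s s.2⟩ - toDual x s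
  /-- Constants `c ∈ ℤ_p` act on `pᵏ`-torsion classes through `ℤ_p → ℤ/pᵏ`. -/
  toDual_C_smul : ∀ (c : ℤ_[p]) (x : X) (s : strictSignedSelmerInfty W κ E ε) (k : ℕ),
    (p ^ k) • s = 0 → toDual (PowerSeries.C c • x) s = (PadicInt.toZModPow k c).val • toDual x s

/-- The dual of a datum is an abelian group (instance on the new type `D.X`).
[cite: Kobayashi2003, Def. 2.1 and Thm. 2.2 (the object only)] -/
instance StrictSignedSelmerDualData.instAddCommGroupX {W : WeierstrassCurve K} {κ : ZpExtension K p}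
    {E : Type u} [Field E] [Algebra K E] {γ : Field.absoluteGaloisGroup K} {ε : ℤˣ}
    (D : StrictSignedSelmerDualData W κ E γ ε) :
    AddCommGroup D.X :=
  D.addCommGroup

/-- The dual of a datum is a `Λ`-module (instance on `D.X`).
[cite: Kobayashi2003, Def. 2.1 and Thm. 2.2 (the object only)] -/
instance StrictSignedSelmerDualData.instModuleX {W : WeierstrassCurve K} {κ : ZpExtension K p}
    {E : Type u} [Field E] [Algebra K E] {γ : Field.absoluteGaloisGroup K} {ε : ℤˣ}
    (D : StrictSignedSelmerDualData W κ E γ ε) :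
    Module (IwasawaAlgebra p) D.X :=
  D.module

namespace StrictSignedSelmerDualData

variable {W : WeierstrassCurve K} {κ : ZpExtension K p} {E : Type u} [Field E] [Algebra K E]
  {γ : Field.absoluteGaloisGroup K} {ε : ℤˣ} (D : StrictSignedSelmerDualData W κ E γ ε)

/-- The **characteristic ideal** `Char(X^{ε,str}(E/K_∞)) ⊆ Λ` (`Module.charIdeal`); for `ε = −1` and
the `p*`-twist `W` of a good `a_p = 0` curve `V` a generator is the `W`-coordinate avatar of a
characteristic power series of `X⁻(V/K_∞)^η` — the object of Kobayashi's ODD main conjecture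
"`Char(X⁻(E/K_∞)^η) = (X⁻¹L_p⁻(E, η, X))`" (§4 p. 8; NOT asserted).
[cite: Kobayashi2003, §4 (p. 8) and Thm. 2.2 (the object only)] -/
def charIdeal : Ideal (IwasawaAlgebra p) :=
  Literature.NumberTheory.EllipticCurves.Module.charIdeal (IwasawaAlgebra p) D.X

/-- The **`μ`-invariant** of `X^{ε,str}(E/K_∞)` (`muInvariant`; junk `0` unless finitely generated
torsion). [cite: Kobayashi2003, Thm. 1.4 (the invariants only)] -/
def mu : ℕ :=
  muInvariant p D.X

/-- The **`λ`-invariant** of `X^{ε,str}(E/K_∞)` (`lambdaInvariant`; junk `0` unless finitely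
generated torsion). [cite: Kobayashi2003, Thm. 1.4 (the invariants only)] -/
def lambda : ℕ :=
  lambdaInvariant p D.X

/-- Unfolding `charIdeal` (definitional). [cite: Kobayashi2003, §4 (p. 8; the object only)] -/
theorem charIdeal_def :
    D.charIdeal = Literature.NumberTheory.EllipticCurves.Module.charIdeal (IwasawaAlgebra p) D.X :=
  rfl

end StrictSignedSelmerDualData

end Dual

end Summit.BirchSwinnertonDyer.Rank1Residual.Additive

end
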